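import Literature.Analysis.FunctionSpaces.TorusSobolevNorm
import Mathlib.MeasureTheory.Integral.MeanInequalities
import Mathlib.Analysis.SpecialFunctions.Pow.NNReal
import Mathlib.Analysis.MeanInequalitiesPow
import HarnessLib

/-!
# The Sobolev scale on the frequency lattice `ℤ^d` (Warner, Ch. 6, §§6.13–6.18), part Ia

F. W. Warner (*Foundations of Differentiable Manifolds and Lie Groups*, GTM 94 (1983), Ch. 6)
proves the Hodge theorem from two analytic facts about elliptic operators (his Theorems 6.5 and
6.6), and proves those by Fourier series: a periodic function is identified with its sequence of
Fourier coefficients `u = (u_ξ)_{ξ ∈ ℤ^d}`, the Sobolev space `H_s` (for *every* integer, indeed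
every real, `s`) is the weighted sequence space with norm `‖u‖_s² = ∑_ξ (1 + |ξ|²)^s |u_ξ|²`
(Def. 6.17), derivatives and difference quotients are multipliers (6.17, 6.19), and the whole
elliptic theory (6.18–6.30) is a collection of inequalities between such weighted sums.

This file starts the sequence-level ("lattice") version of that calculus, on which the tree's
function-level spectral norm is built: `Torus.eSobolevNorm s f` (`TorusSobolevNorm.lean`) is by
definition `Lattice.eNorm s (mFourierCoeff f)` (`Torus.eSobolevNorm_eq_eNorm`, `rfl`). Working
with bare coefficient families `c : ℤ^d → V` (any normed group `V`, any real order `s`, values in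
`ℝ≥0∞` so that no summability hypothesis is ever needed) is what makes negative orders and
"generalized functions" (Warner's `S`, `H_{-∞}`) available for free.

## Contents (all proved)

* weights (namespace `Torus`, about `Torus.sobolevWeight`): `⟨k⟩^{s+t} = ⟨k⟩^s ⟨k⟩^t`,
  `(⟨k⟩^s)² = (1+|k|²)^s`, `|k_j| ≤ ⟨k⟩`, and **Peetre's inequality**
  `⟨k⟩^s ≤ 2^{|s|/2} ⟨k-l⟩^{|s|} ⟨l⟩^s` (`Torus.sobolevWeight_le_peetre`), the tool behind every
  convolution estimate of part II;
* `Lattice.eNormSq s c = ∑_k ⟨k⟩^{2s} ‖c k‖²`, `Lattice.eNorm s c = (eNormSq s c)^{1/2}`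
  (Warner 6.17 (1)); monotonicity in `s` (6.18 (b)), scaling, single-term bound, Minkowski's
  inequality `eNorm s (c + c') ≤ eNorm s c + eNorm s c'`, finite sums, and the **domination
  principle** `‖c' k‖ ≤ C ⟨k⟩^t ‖c k‖ ⇒ ‖c'‖_s ≤ C ‖c‖_{s+t}` (multipliers of order `t`, 6.18 (h));

The derivative multipliers `∂_j ↔ 2πi k_j`, difference quotients and Warner's Lemma 6.20 are part Ib
(`LatticeSobolevDeriv.lean`); Rellich's lemma (6.23), the Sobolev lemma in the form
"`⋂_s H_s` = rapidly decreasing families" (6.22) and the duality `H_{-s} = (H_s)'` (6.18 (f)) are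
part Ic (`LatticeSobolevRellich.lean`); convolution (multiplication) operators are part II.

## Duplication note

Three one-line weight lemmas (`Torus.sobolevWeight_add`, `Torus.sobolevWeight_one_sq`,
`Torus.sq_apply_le_freqNormSq`) and `(a+b)² ≤ 2a²+2b²` in `ℝ≥0∞` have file-local twins inside
`Literature/Analysis/FluidPDE/` (`SteadyNS.*`, `CorrectorFourier.*`, `PoincareBall.*`). They are
restated here, next to `Torus.sobolevWeight` itself, because a foundational `FunctionSpaces` file
must not import the Navier–Stokes files that happen to contain them; the fluid copies can later be
re-derived from these.

## References

* F. W. Warner, *Foundations of Differentiable Manifolds and Lie Groups*, GTM 94, Springer (1983),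
  Ch. 6: 6.17 (Sobolev spaces `H_s` as sequence spaces), 6.18 (a), (b), (h). [WarnerGTM94]
* J. Peetre, *Espaces d'interpolation et théorème de Soboleff*, Ann. Inst. Fourier 16 (1966) —
  the inequality `(1+|ξ|²)^s ≤ 2^{|s|}(1+|ξ-η|²)^{|s|}(1+|η|²)^s`. [folklore]
-/

open MeasureTheory Filter
open scoped ENNReal NNReal Topology

noncomputable section

namespace Literature.Analysis.FunctionSpaces

/-! ## Weights: products, squares, Peetre's inequality -/

namespace Torus

variable {d : Type*} [Fintype d]

/-- `⟨k⟩^{s+t} = ⟨k⟩^s ⟨k⟩^t`. [folklore] -/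
theorem sobolevWeight_add (s t : ℝ) (k : d → ℤ) :
    sobolevWeight (s + t) k = sobolevWeight s k * sobolevWeight t k := by
  have h : 0 < 1 + freqNormSq k := by linarith [freqNormSq_nonneg k]
  rw [sobolevWeight, sobolevWeight, sobolevWeight, ← Real.rpow_add h, add_div]

/-- `(⟨k⟩^s)² = (1 + |k|²)^s`. [folklore] -/
theorem sobolevWeight_sq (s : ℝ) (k : d → ℤ) : sobolevWeight s k ^ 2 = (1 + freqNormSq k) ^ s := by
  have h : 0 ≤ 1 + freqNormSq k := by linarith [freqNormSq_nonneg k]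
  rw [sobolevWeight, ← Real.rpow_natCast, ← Real.rpow_mul h]
  norm_num

/-- `⟨k⟩^1 ² = 1 + |k|²`. [folklore] -/
theorem sobolevWeight_one_sq (k : d → ℤ) : sobolevWeight 1 k ^ 2 = 1 + freqNormSq k := by
  rw [sobolevWeight_sq, Real.rpow_one]

/-- `1 ≤ ⟨k⟩^s` for `s ≥ 0`. [folklore] -/
theorem one_le_sobolevWeight {s : ℝ} (hs : 0 ≤ s) (k : d → ℤ) : 1 ≤ sobolevWeight s k := by
  simpa using sobolevWeight_mono hs k

/-- `⟨k⟩^s ≤ 1` for `s ≤ 0`. [folklore] -/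
theorem sobolevWeight_le_one {s : ℝ} (hs : s ≤ 0) (k : d → ℤ) : sobolevWeight s k ≤ 1 := by
  simpa using sobolevWeight_mono hs k

/-- `⟨k⟩^{-s} = (⟨k⟩^s)⁻¹`. [folklore] -/
theorem sobolevWeight_neg (s : ℝ) (k : d → ℤ) : sobolevWeight (-s) k = (sobolevWeight s k)⁻¹ :=
  eq_inv_of_mul_eq_one_left (sobolevWeight_neg_mul_sobolevWeight s k)

/-- `k_j² ≤ |k|²`. [folklore] -/
theorem sq_apply_le_freqNormSq (k : d → ℤ) (j : d) : (k j : ℝ) ^ 2 ≤ freqNormSq k :=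
  Finset.single_le_sum (f := fun i => (k i : ℝ) ^ 2) (fun i _ => sq_nonneg (k i : ℝ)) (Finset.mem_univ j)

/-- `|k_j| ≤ ⟨k⟩` (Warner 6.18 (11) for `|α| = 1`). [cite: WarnerGTM94, 6.18 (11)] -/
theorem abs_apply_le_sobolevWeight_one (k : d → ℤ) (j : d) : |(k j : ℝ)| ≤ sobolevWeight 1 k := by
  rw [← Real.sqrt_sq_eq_abs, sobolevWeight, ← Real.sqrt_eq_rpow]
  exact Real.sqrt_le_sqrt (by linarith [sq_apply_le_freqNormSq k j])

/-- `|k - l|² = |l - k|²`. [folklore] -/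
theorem freqNormSq_sub_comm (k l : d → ℤ) : freqNormSq (k - l) = freqNormSq (l - k) := by
  rw [← freqNormSq_neg, neg_sub]

/-- The elementary inequality behind Peetre's: `1 + |k|² ≤ 2 (1 + |k - l|²)(1 + |l|²)`
(from `|k|² ≤ 2|k-l|² + 2|l|²`). [folklore] -/
theorem one_add_freqNormSq_le (k l : d → ℤ) :
    1 + freqNormSq k ≤ 2 * (1 + freqNormSq (k - l)) * (1 + freqNormSq l) := by
  have h1 : freqNormSq k ≤ 2 * freqNormSq (k - l) + 2 * freqNormSq l := by
    simp only [freqNormSq, Finset.mul_sum, ← Finset.sum_add_distrib, Pi.sub_apply, Int.cast_sub]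
    exact Finset.sum_le_sum fun i _ => by nlinarith [sq_nonneg ((k i : ℝ) - l i - l i)]
  nlinarith [freqNormSq_nonneg (k - l), freqNormSq_nonneg l,
    mul_nonneg (freqNormSq_nonneg (k - l)) (freqNormSq_nonneg l)]

/-- Peetre's inequality for non-negative order: `⟨k⟩^s ≤ 2^{s/2} ⟨k-l⟩^s ⟨l⟩^s` (`s ≥ 0`).
[folklore] -/
theorem sobolevWeight_le_peetre_of_nonneg {s : ℝ} (hs : 0 ≤ s) (k l : d → ℤ) :
    sobolevWeight s k ≤ (2 : ℝ) ^ (s / 2) * sobolevWeight s (k - l) * sobolevWeight s l := by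
  have hs' : 0 ≤ s / 2 := by linarith
  have h0 : 0 ≤ 1 + freqNormSq k := by linarith [freqNormSq_nonneg k]
  have hA : 0 ≤ 1 + freqNormSq (k - l) := by linarith [freqNormSq_nonneg (k - l)]
  have hB : 0 ≤ 1 + freqNormSq l := by linarith [freqNormSq_nonneg l]
  calc sobolevWeight s k = (1 + freqNormSq k) ^ (s / 2) := rfl
    _ ≤ (2 * (1 + freqNormSq (k - l)) * (1 + freqNormSq l)) ^ (s / 2) :=
        Real.rpow_le_rpow h0 (one_add_freqNormSq_le k l) hs'
    _ = (2 : ℝ) ^ (s / 2) * sobolevWeight s (k - l) * sobolevWeight s l := by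
        rw [Real.mul_rpow (by positivity) hB, Real.mul_rpow (by norm_num) hA]
        rfl

/-- **Peetre's inequality** on the lattice, every real order:
`⟨k⟩^s ≤ 2^{|s|/2} ⟨k - l⟩^{|s|} ⟨l⟩^s`. For `s < 0` it is the case `-s ≥ 0` applied to the pair
`(l, k)`. This is what makes convolution by a rapidly decreasing family bounded on every `H_s`
(Warner 6.18 (i) in sequence form). [folklore] -/
theorem sobolevWeight_le_peetre (s : ℝ) (k l : d → ℤ) :
    sobolevWeight s k ≤ (2 : ℝ) ^ (|s| / 2) * sobolevWeight |s| (k - l) * sobolevWeight s l := by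
  rcases le_or_gt 0 s with hs | hs
  · rw [abs_of_nonneg hs]; exact sobolevWeight_le_peetre_of_nonneg hs k l
  · have hs' : 0 ≤ -s := by linarith
    rw [abs_of_neg hs]
    -- the non-negative case for the pair `(l, k)` with exponent `-s`
    have h := sobolevWeight_le_peetre_of_nonneg hs' l k
    have hlk : sobolevWeight (-s) (l - k) = sobolevWeight (-s) (k - l) := by
      rw [sobolevWeight, sobolevWeight, freqNormSq_sub_comm]
    rw [hlk, sobolevWeight_neg s l, sobolevWeight_neg s k] at h
    have hk := sobolevWeight_pos s k
    have hl := sobolevWeight_pos s l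
    have h2 := mul_le_mul_of_nonneg_right h (mul_nonneg hk.le hl.le)
    calc sobolevWeight s k
        = (sobolevWeight s l)⁻¹ * (sobolevWeight s k * sobolevWeight s l) := by
          field_simp
      _ ≤ (2 : ℝ) ^ (-s / 2) * sobolevWeight (-s) (k - l) * (sobolevWeight s k)⁻¹ *
            (sobolevWeight s k * sobolevWeight s l) := h2
      _ = (2 : ℝ) ^ (-s / 2) * sobolevWeight (-s) (k - l) * sobolevWeight s l := by
          field_simp

end Torus

/-! ## The lattice Sobolev norms -/

namespace Lattice

open Torus

variable {d : Type*}
variable {V W : Type*} [NormedAddCommGroup V] [NormedAddCommGroup W]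

section Norms

variable [Fintype d]

/-- The squared `H_s` norm of a coefficient family `c : ℤ^d → V`,
`‖c‖_s² = ∑_k ⟨k⟩^{2s} ‖c k‖² ∈ [0, ∞]` (Warner (1983), 6.17 (1): "`‖u‖_s² = ∑_ξ (1+|ξ|²)^s |u_ξ|²`",
with the tree's normalisation `⟨k⟩ = (1+|k|²)^{1/2}` of `Torus.sobolevWeight`). Values in `ℝ≥0∞`:
`c ∈ H_s` is the assertion `eNormSq s c < ∞`. [cite: WarnerGTM94, 6.17 (1)] -/
def eNormSq (s : ℝ) (c : (d → ℤ) → V) : ℝ≥0∞ :=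
  ∑' k, ENNReal.ofReal (sobolevWeight s k ^ 2) * ‖c k‖ₑ ^ 2

/-- The `H_s` norm `‖c‖_s = (∑_k ⟨k⟩^{2s} ‖c k‖²)^{1/2} ∈ [0, ∞]` of a coefficient family
(Warner (1983), 6.17 (1)). [cite: WarnerGTM94, 6.17 (1)] -/
def eNorm (s : ℝ) (c : (d → ℤ) → V) : ℝ≥0∞ :=
  (eNormSq s c) ^ (1 / 2 : ℝ)

/-- The tree's spectral Sobolev norm of a function on `T^d` is the lattice norm of its Fourier
coefficients (definitional). [folklore] -/
theorem _root_.Literature.Analysis.FunctionSpaces.Torus.eSobolevNorm_eq_eNorm [NormedSpace ℂ V]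
    (s : ℝ) (f : UnitAddTorus d → V) : Torus.eSobolevNorm s f = eNorm s (UnitAddTorus.mFourierCoeff f) :=
  rfl

/-- Unfolding: `‖c‖_s = (‖c‖²_s)^{1/2}`. [folklore] -/
theorem eNorm_eq_rpow (s : ℝ) (c : (d → ℤ) → V) : eNorm s c = (eNormSq s c) ^ (1 / 2 : ℝ) := rfl

/-- `‖c‖_s² = (‖c‖_s)²`. [folklore] -/
theorem eNorm_pow_two (s : ℝ) (c : (d → ℤ) → V) : eNorm s c ^ 2 = eNormSq s c := by
  rw [eNorm, ← ENNReal.rpow_natCast, ← ENNReal.rpow_mul]; norm_num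

/-- `‖c‖_s < ∞ ↔ ‖c‖_s² < ∞`. [folklore] -/
theorem eNorm_lt_top_iff {s : ℝ} {c : (d → ℤ) → V} : eNorm s c < ∞ ↔ eNormSq s c < ∞ := by
  rw [eNorm, ENNReal.rpow_lt_top_iff_of_pos (by norm_num : (0 : ℝ) < 1 / 2)]

/-- `‖c‖_s ≤ ‖c'‖_{s'} ↔ ‖c‖²_s ≤ ‖c'‖²_{s'}`. [folklore] -/
theorem eNorm_le_eNorm_iff {s s' : ℝ} {c : (d → ℤ) → V} {c' : (d → ℤ) → W} :
    eNorm s c ≤ eNorm s' c' ↔ eNormSq s c ≤ eNormSq s' c' := by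
  rw [eNorm, eNorm, ENNReal.rpow_le_rpow_iff (by norm_num : (0 : ℝ) < 1 / 2)]

/-- The zero family has norm zero. [folklore] -/
@[simp] theorem eNormSq_zero (s : ℝ) : eNormSq s (0 : (d → ℤ) → V) = 0 := by
  simp [eNormSq]

/-- The zero family has `H_s` norm zero. [folklore] -/
@[simp] theorem eNorm_zero (s : ℝ) : eNorm s (0 : (d → ℤ) → V) = 0 := by
  simp [eNorm, eNormSq_zero]

/-- `‖-c‖_s = ‖c‖_s`. [folklore] -/
@[simp] theorem eNormSq_neg (s : ℝ) (c : (d → ℤ) → V) : eNormSq s (-c) = eNormSq s c := by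
  simp [eNormSq]

/-- `‖c - c'‖_s = ‖c' - c‖_s`. [folklore] -/
theorem eNormSq_sub_comm (s : ℝ) (c c' : (d → ℤ) → V) : eNormSq s (c - c') = eNormSq s (c' - c) := by
  rw [← eNormSq_neg, neg_sub]

/-- A single term is bounded by the whole sum: `⟨k⟩^{2s} ‖c k‖² ≤ ‖c‖²_s`. [folklore] -/
theorem term_le_eNormSq (s : ℝ) (c : (d → ℤ) → V) (k : d → ℤ) :
    ENNReal.ofReal (sobolevWeight s k ^ 2) * ‖c k‖ₑ ^ 2 ≤ eNormSq s c :=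
  ENNReal.le_tsum (f := fun k => ENNReal.ofReal (sobolevWeight s k ^ 2) * ‖c k‖ₑ ^ 2) k

/-- Pointwise bound from the norm: `‖c k‖ ≤ ⟨k⟩^{-s} ‖c‖_s`. [folklore] -/
theorem enorm_apply_le (s : ℝ) (c : (d → ℤ) → V) (k : d → ℤ) :
    ‖c k‖ₑ ≤ ENNReal.ofReal (sobolevWeight (-s) k) * eNorm s c := by
  have hw := sobolevWeight_pos s k
  have h1 : (ENNReal.ofReal (sobolevWeight s k) * ‖c k‖ₑ) ^ 2 ≤ eNormSq s c := by
    rw [mul_pow, ← ENNReal.ofReal_pow hw.le]; exact term_le_eNormSq s c k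
  have h2 : ENNReal.ofReal (sobolevWeight s k) * ‖c k‖ₑ ≤ eNorm s c := by
    rw [eNorm, ← ENNReal.rpow_le_rpow_iff (by norm_num : (0 : ℝ) < 2), ← ENNReal.rpow_mul]
    norm_num [h1]
  calc ‖c k‖ₑ = ENNReal.ofReal (sobolevWeight (-s) k) * (ENNReal.ofReal (sobolevWeight s k) * ‖c k‖ₑ) := by
        rw [← mul_assoc, ← ENNReal.ofReal_mul (sobolevWeight_pos _ _).le,
          sobolevWeight_neg_mul_sobolevWeight, ENNReal.ofReal_one, one_mul]
    _ ≤ ENNReal.ofReal (sobolevWeight (-s) k) * eNorm s c := by gcongr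

/-- Monotonicity in the order (Warner 6.18 (b)): `‖c‖_{s'} ≤ ‖c‖_s` for `s' ≤ s`, i.e.
`H_s ⊆ H_{s'}`. [cite: WarnerGTM94, 6.18 (b)] -/
theorem eNormSq_mono {s s' : ℝ} (h : s' ≤ s) (c : (d → ℤ) → V) : eNormSq s' c ≤ eNormSq s c :=
  ENNReal.tsum_le_tsum fun k => mul_le_mul'
    (ENNReal.ofReal_le_ofReal (pow_le_pow_left₀ (sobolevWeight_pos _ _).le (sobolevWeight_mono h k) 2))
    le_rfl

/-- `‖c‖_{s'} ≤ ‖c‖_s` for `s' ≤ s` (Warner 6.18 (b)). [cite: WarnerGTM94, 6.18 (b)] -/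
theorem eNorm_mono {s s' : ℝ} (h : s' ≤ s) (c : (d → ℤ) → V) : eNorm s' c ≤ eNorm s c :=
  eNorm_le_eNorm_iff.2 (eNormSq_mono h c)

/-- Scaling: `‖a • c‖²_s = ‖a‖² ‖c‖²_s`. [folklore] -/
theorem eNormSq_const_smul {𝕜 : Type*} [NormedField 𝕜] [NormedSpace 𝕜 V] (s : ℝ) (a : 𝕜)
    (c : (d → ℤ) → V) : eNormSq s (a • c) = ‖a‖ₑ ^ 2 * eNormSq s c := by
  simp only [eNormSq, Pi.smul_apply, enorm_smul, mul_pow, ← ENNReal.tsum_mul_left]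
  exact tsum_congr fun k => by ring

/-- Scaling of the norm: `‖a • c‖_s = ‖a‖ ‖c‖_s`. [folklore] -/
theorem eNorm_const_smul {𝕜 : Type*} [NormedField 𝕜] [NormedSpace 𝕜 V] (s : ℝ) (a : 𝕜)
    (c : (d → ℤ) → V) : eNorm s (a • c) = ‖a‖ₑ * eNorm s c := by
  rw [eNorm, eNormSq_const_smul, ENNReal.mul_rpow_of_nonneg _ _ (by norm_num), eNorm,
    ← ENNReal.rpow_natCast, ← ENNReal.rpow_mul]
  norm_num

/-- **Domination principle** (multipliers of order `t`, Warner 6.18 (h) in general form): if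
`‖c' k‖ ≤ C ⟨k⟩^t ‖c k‖` termwise, then `‖c'‖²_s ≤ C² ‖c‖²_{s+t}`. [cite: WarnerGTM94, 6.18 (h)] -/
theorem eNormSq_le_of_norm_le {c : (d → ℤ) → V} {c' : (d → ℤ) → W} {C : ℝ} (hC : 0 ≤ C)
    {s t : ℝ} (h : ∀ k, ‖c' k‖ ≤ C * sobolevWeight t k * ‖c k‖) :
    eNormSq s c' ≤ ENNReal.ofReal (C ^ 2) * eNormSq (s + t) c := by
  rw [eNormSq, eNormSq, ← ENNReal.tsum_mul_left]
  refine ENNReal.tsum_le_tsum fun k => ?_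
  have hw : 0 ≤ C * sobolevWeight t k := mul_nonneg hC (sobolevWeight_pos t k).le
  have hk : ‖c' k‖ₑ ≤ ENNReal.ofReal (C * sobolevWeight t k) * ‖c k‖ₑ := by
    rw [← ofReal_norm, ← ofReal_norm, ← ENNReal.ofReal_mul hw]
    exact ENNReal.ofReal_le_ofReal (h k)
  calc ENNReal.ofReal (sobolevWeight s k ^ 2) * ‖c' k‖ₑ ^ 2
      ≤ ENNReal.ofReal (sobolevWeight s k ^ 2) * (ENNReal.ofReal (C * sobolevWeight t k) * ‖c k‖ₑ) ^ 2 := by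
        gcongr
    _ = ENNReal.ofReal (C ^ 2) * (ENNReal.ofReal (sobolevWeight (s + t) k ^ 2) * ‖c k‖ₑ ^ 2) := by
        rw [mul_pow, ← ENNReal.ofReal_pow hw, mul_pow, sobolevWeight_add, mul_pow,
          ENNReal.ofReal_mul (sq_nonneg _), ENNReal.ofReal_mul (sq_nonneg _)]
        ring

/-- Domination principle for the norms: `‖c' k‖ ≤ C ⟨k⟩^t ‖c k‖ ⇒ ‖c'‖_s ≤ C ‖c‖_{s+t}`.
[cite: WarnerGTM94, 6.18 (h)] -/
theorem eNorm_le_of_norm_le {c : (d → ℤ) → V} {c' : (d → ℤ) → W} {C : ℝ} (hC : 0 ≤ C)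
    {s t : ℝ} (h : ∀ k, ‖c' k‖ ≤ C * sobolevWeight t k * ‖c k‖) :
    eNorm s c' ≤ ENNReal.ofReal C * eNorm (s + t) c := by
  have := eNormSq_le_of_norm_le hC (s := s) h
  rw [eNorm, eNorm, ← ENNReal.rpow_le_rpow_iff (by norm_num : (0 : ℝ) < 2),
    ENNReal.mul_rpow_of_nonneg _ _ (by norm_num), ← ENNReal.rpow_mul, ← ENNReal.rpow_mul]
  norm_num
  rwa [← ENNReal.ofReal_pow hC]

/-- Same-order domination: `‖c' k‖ ≤ C ‖c k‖ ⇒ ‖c'‖²_s ≤ C² ‖c‖²_s`. [folklore] -/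
theorem eNormSq_le_of_norm_le' {c : (d → ℤ) → V} {c' : (d → ℤ) → W} {C : ℝ} (hC : 0 ≤ C)
    {s : ℝ} (h : ∀ k, ‖c' k‖ ≤ C * ‖c k‖) : eNormSq s c' ≤ ENNReal.ofReal (C ^ 2) * eNormSq s c := by
  simpa using eNormSq_le_of_norm_le hC (s := s) (t := 0) (fun k => by simpa using h k)

/-- Termwise comparison with equal weights: `‖c' k‖ ≤ ‖c k‖ ⇒ ‖c'‖²_s ≤ ‖c‖²_s`. [folklore] -/
theorem eNormSq_le_of_norm_le_norm {c : (d → ℤ) → V} {c' : (d → ℤ) → W} {s : ℝ}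
    (h : ∀ k, ‖c' k‖ ≤ ‖c k‖) : eNormSq s c' ≤ eNormSq s c := by
  simpa using eNormSq_le_of_norm_le' zero_le_one (s := s) (fun k => by simpa using h k)

/-- The squared norm as an integral for the counting measure (for Minkowski). [folklore] -/
theorem eNorm_eq_lintegral_count (s : ℝ) (c : (d → ℤ) → V) :
    eNorm s c = (∫⁻ k, (fun k => ENNReal.ofReal (sobolevWeight s k) * ‖c k‖ₑ) k ^ (2 : ℝ)
      ∂Measure.count) ^ (1 / (2 : ℝ)) := by
  rw [lintegral_count, eNorm, eNormSq]
  congr 1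
  refine tsum_congr fun k => ?_
  rw [ENNReal.rpow_two, mul_pow, ENNReal.ofReal_pow (sobolevWeight_pos s k).le]

/-- **Minkowski's inequality** in `H_s`: `‖c + c'‖_s ≤ ‖c‖_s + ‖c'‖_s`. [folklore] -/
theorem eNorm_add_le (s : ℝ) (c c' : (d → ℤ) → V) : eNorm s (c + c') ≤ eNorm s c + eNorm s c' := by
  simp only [eNorm_eq_lintegral_count]
  calc (∫⁻ k, (ENNReal.ofReal (sobolevWeight s k) * ‖(c + c') k‖ₑ) ^ (2 : ℝ) ∂Measure.count) ^ (1 / (2 : ℝ))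
      ≤ (∫⁻ k, ((fun k => ENNReal.ofReal (sobolevWeight s k) * ‖c k‖ₑ) +
            (fun k => ENNReal.ofReal (sobolevWeight s k) * ‖c' k‖ₑ)) k ^ (2 : ℝ) ∂Measure.count) ^
          (1 / (2 : ℝ)) := by
        gcongr with k
        simp only [Pi.add_apply, ← mul_add]
        gcongr
        exact enorm_add_le _ _
    _ ≤ _ := ENNReal.lintegral_Lp_add_le (Measurable.of_discrete.aemeasurable)
          (Measurable.of_discrete.aemeasurable) (by norm_num)

/-- `‖c - c'‖_s ≤ ‖c‖_s + ‖c'‖_s`. [folklore] -/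
theorem eNorm_sub_le (s : ℝ) (c c' : (d → ℤ) → V) : eNorm s (c - c') ≤ eNorm s c + eNorm s c' := by
  simpa [sub_eq_add_neg, eNorm, eNormSq_neg] using eNorm_add_le s c (-c')

/-- Minkowski for finite sums: `‖∑_{i ∈ F} c i‖_s ≤ ∑_{i ∈ F} ‖c i‖_s`. [folklore] -/
theorem eNorm_sum_le {ι : Type*} (s : ℝ) (F : Finset ι) (c : ι → (d → ℤ) → V) :
    eNorm s (∑ i ∈ F, c i) ≤ ∑ i ∈ F, eNorm s (c i) := by
  classical
  induction F using Finset.induction_on with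
  | empty => simp
  | insert i F hi ih =>
      rw [Finset.sum_insert hi, Finset.sum_insert hi]
      exact (eNorm_add_le s _ _).trans (by gcongr)

/-- `(a + b)² ≤ 2a² + 2b²` in `ℝ≥0∞` (a copy of the `FluidPDE`-local
`Literature.Analysis.FluidPDE.PoincareBall.add_sq_le_two_mul_sq_add`, kept here so that this
foundational file does not import the fluid files). [folklore] -/
theorem ennreal_add_pow_two_le (a b : ℝ≥0∞) : (a + b) ^ 2 ≤ 2 * a ^ 2 + 2 * b ^ 2 := by
  have h := ENNReal.rpow_add_le_mul_rpow_add_rpow a b (le_refl (1 : ℝ) |>.trans one_le_two)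
  norm_num at h
  simpa [ENNReal.rpow_two, mul_add] using h

/-- The crude but summability-free bound `‖c + c'‖²_s ≤ 2‖c‖²_s + 2‖c'‖²_s`. [folklore] -/
theorem eNormSq_add_le (s : ℝ) (c c' : (d → ℤ) → V) :
    eNormSq s (c + c') ≤ 2 * eNormSq s c + 2 * eNormSq s c' := by
  simp only [eNormSq, ← ENNReal.tsum_mul_left, ← ENNReal.tsum_add]
  refine ENNReal.tsum_le_tsum fun k => ?_
  calc ENNReal.ofReal (sobolevWeight s k ^ 2) * ‖(c + c') k‖ₑ ^ 2
      ≤ ENNReal.ofReal (sobolevWeight s k ^ 2) * (‖c k‖ₑ + ‖c' k‖ₑ) ^ 2 := by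
        gcongr; exact enorm_add_le _ _
    _ ≤ ENNReal.ofReal (sobolevWeight s k ^ 2) * (2 * ‖c k‖ₑ ^ 2 + 2 * ‖c' k‖ₑ ^ 2) := by
        gcongr; exact ennreal_add_pow_two_le _ _
    _ = _ := by ring_nf

/-- `‖c - c'‖²_s ≤ 2‖c‖²_s + 2‖c'‖²_s`. [folklore] -/
theorem eNormSq_sub_le (s : ℝ) (c c' : (d → ℤ) → V) :
    eNormSq s (c - c') ≤ 2 * eNormSq s c + 2 * eNormSq s c' := by
  simpa [sub_eq_add_neg] using eNormSq_add_le s c (-c')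

omit [Fintype d] in
/-- A `tsum` over the lattice commutes with a finite sum (everything is summable in `ℝ≥0∞`).
[folklore] -/
theorem tsum_finsetSum_comm {ι : Type*} (F : Finset ι) (f : ι → (d → ℤ) → ℝ≥0∞) :
    ∑' k, ∑ i ∈ F, f i k = ∑ i ∈ F, ∑' k, f i k :=
  Summable.tsum_finsetSum fun _ _ => ENNReal.summable

end Norms

end Lattice

end Literature.Analysis.FunctionSpaces
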